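import Summits.QuantumFields.BalabanUV.Beta.SymRootedMixedJetLinear
import Summits.QuantumFields.BalabanUV.Beta.RootedMixedJetSigns

/-!
# `BalabanUV.Beta.SymRootedMixedJetSigns` — NATURALITY OF THE (0.4)-SYMMETRISED ROOTED MIXED CHART AND THE ODDNESS OF `symMjetAt` IN EACH FLUCTUATION LETTER
# (β sub-cell, row D1, TABLES-SYM-LEAN S2c, INTERFACE-LEVEL twin of an3's `RootedMixedJetSigns` §1–§2; an1 gen 43)

HONEST FRAMING (cell charter, verbatim): «discharging BetaPertH makes Bałaban's UV stability UNCONDITIONAL — a real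
constructive-QFT result; it is NOT the continuum limit and NOT the Clay problem.»  HONEST DEPENDENCY (verbatim): «continuum YM on
T⁴ ⇐ BetaPertH ∧ nine spine estimates (0/9 proved); BetaPertH ⇐ (D1) ∧ (D4) ∧ CAP+tail; G-an2-4 gates asym, D1 and NE2/3/4.»
ABSOLUTE RULE (R-g25-7 ∕ R-D1-g30-1 (A)): the (0.4)-symmetrised averaging is the exp of the MEAN OF LOGS over the pair family
`{loop^{σ,σ′}}` with weight `((d!)²·L^d)⁻¹`; every object below is the comb module's algebra read on an1's `symPhiGAt` (S2b part 1)
instead of `PhiGAt` — STATEMENT FOR STATEMENT under the dictionary `PhiXAt ↦ symPhiXAt`, `XjetAt ↦ symXjetAt`, `MσXAt ↦ symMσXAt`,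
`L^{-d}·linAvgAt ↦ (d!·L^d)⁻¹·symLinU`, `L^{-d}·hessUAt ↦ ((d!)²L^d)⁻¹·symHessUAt`, `L^{-2d}·vhUAt ↦ ((d!)²L^{2d})⁻¹·symVhUAt`
(an3-g63 [AN3-G63-S2C] (C-ii): constants PER BCH ORDER; CONVENTION `(d!)²` un-normalised inside order-2 sym functionals).
FAMILY-INDEPENDENT chart ∕ letter ∕ `Tau`-algebra lemmas of the comb module are imported BY NAME, never re-proved.
DERIVED cell leaf: [folklore] ring algebra; the `sym*` families are [our object]s.  No statement of Bałaban's papers is typed here, no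
`[cite:]` tag, no `Prop` is minted, no binder of the β-function wall (`hW`/`hR`/`D1Tel`/`D1Rep`, (D1), `BetaPertH`) is instantiated or
discharged; nothing about the VALUES of `symMixFFAt`∕`symVh₂SAt` and no (T2-B)∕(T2-M₂) letter is discharged in this file.
NOT D1, NOT BetaPertH, NOT continuum, NOT Clay.  NOT summit progress.
Provenance: β sub-cell, TABLES-SYM-LEAN S2c option (C) (S2C-SCOPE-v1 94facb80ac685517), unit b2b-balaban-beta-an1-g43 (W-supplier AN1,
FREEZE (0): scratch for a courier; an1 files nothing), 2026-08-21; no existing file touched.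

## What this module proves (sym twin of `RootedMixedJetSigns` §1–§2; the flips `flip2`, `flip1_Zf`∕`flip1_Zb`∕`flip2_Zf`∕`flip2_Zb`, `mapDual_GmL`∕`mapDual_GmbL` and the
## §3 letter lemmas `R1g_single`∕`R1g_add`∕…∕`upF_R1g` are family-independent, the comb module's BY NAME)
* §1 NATURALITY `map_symPhiMLAt`, `map_symMσGAt`, `map_symMσLAt`, `map_symMjetLAt_eq` (an1's `map_symPhiGAt`).
* §2 ODDNESS `symMjetAt_neg_W`, `symMjetAt_neg_V`.
-/

namespace Summit.QuantumFields.BalabanUV.Beta.SymRootedMixedJetSigns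

open Literature.MathematicalPhysics.QuantumFieldTheory.Balaban1983to89
open Literature.MathematicalPhysics.QuantumFieldTheory.Balaban1983to89.Beta
open AffineAveraging (Form1)
open AveragingThirdJet (Tau Rho dmk fst_dmk snd_dmk dfst_mul dsnd_mul mapDual fst_mapDual snd_mapDual scaleDual fst_scaleDual
  snd_scaleDual upF upF_apply logT invT map_logT map_invT)
open AveragingThirdJet.Tau (τ₁ τ₂ τ12 ι c00 c10 c01 c11 ext4)
open AveragingMixedJetTables (Zf Zb)
open ResolventReflection (bref bref_bref)
open Summit.QuantumFields.BalabanUV.Beta.RootedHolonomyReflection (R1g)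
open Summit.QuantumFields.BalabanUV.Beta.RootedMixedChartReflection (GmL GmbL)
open Summit.QuantumFields.BalabanUV.Beta.SymRootedMixedChartReflection (symPhiMLAt symMσLAt symMjetLAt symMjetLAt_eq_c11 symPhiMAt_eq_symPhiMLAt symMjetAt_eq_symMjetLAt)
open Summit.QuantumFields.BalabanUV.Beta.SymRootedMixedJetLinear (symMσGAt)
open Summit.QuantumFields.BalabanUV.Beta.SymAveragingMixedJetTables (symPhiGAt map_symPhiGAt symPhiMAt symMjetAt)
open Summit.QuantumFields.BalabanUV.Beta.RootedMixedJetSigns (mapDual_GmL mapDual_GmbL flip2 c00_flip2 c10_flip2 c01_flip2 c11_flip2 flip2_ι flip1_Zf flip1_Zb flip2_Zf flip2_Zb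
  R1g_single R1g_add R1g_neg R1g_sub R1g_R1g upF_single upF_R1g)
open Summit.QuantumFields.BalabanUV.Beta.RootedJetTwist (flip1 c00_flip1 c10_flip1 c01_flip1 c11_flip1 flip1_ι)

variable {𝕜 : Type*} [Field 𝕜] {d : ℕ} {𝔸 : Type*} [Ring 𝔸] [Algebra 𝕜 𝔸]

/-! ## §1 Naturality of the mixed chart in the letter algebra -/

section Naturality

variable {R R' : Type*} [Ring R] [Algebra 𝕜 R] [Ring R'] [Algebra 𝕜 R'] (F : Tau R →ₐ[𝕜] Tau R')

/-- [folklore] **NATURALITY OF THE ROOTED MIXED AVERAGING**: `mapDual F (Φ^L(Z, Z̄′, b)) = Φ^L(F∘Z, F∘Z̄′, F∘b)`. -/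
theorem map_symPhiMLAt (ρ : Fin d → ℤ) (Z Zb' b : Form1 d (Tau R)) (L : ℕ) (μ : Fin d) (y : Fin d → ℤ) :
    mapDual F (symPhiMLAt 𝕜 ρ Z Zb' b L μ y)
      = symPhiMLAt 𝕜 ρ (fun κ x => F (Z κ x)) (fun κ x => F (Zb' κ x)) (fun κ x => F (b κ x)) L μ y := by
  unfold symPhiMLAt
  rw [map_symPhiGAt]
  simp only [mapDual_GmL, mapDual_GmbL]

set_option synthInstance.maxHeartbeats 200000 in
set_option maxHeartbeats 1600000 in
/-- [folklore] **NATURALITY OF THE TWO-BACKGROUND σ-JET**: `F (symMσGAt Z Z̄′ b Z₀ Z̄₀ c) = symMσGAt (F∘Z) (F∘Z̄′) (F∘b) (F∘Z₀) (F∘Z̄₀) (F∘c)`. -/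
theorem map_symMσGAt (ρ : Fin d → ℤ) (Z Zb' b Z₀ Zb₀ c : Form1 d (Tau R)) (L : ℕ) (μ : Fin d) (y : Fin d → ℤ) :
    F (symMσGAt 𝕜 ρ Z Zb' b Z₀ Zb₀ c L μ y)
      = symMσGAt 𝕜 ρ (fun κ x => F (Z κ x)) (fun κ x => F (Zb' κ x)) (fun κ x => F (b κ x))
          (fun κ x => F (Z₀ κ x)) (fun κ x => F (Zb₀ κ x)) (fun κ x => F (c κ x)) L μ y := by
  unfold symMσGAt
  have key := congrArg TrivSqZeroExt.snd (map_logT (mapDual F)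
    (symPhiMLAt 𝕜 ρ Z Zb' b L μ y * invT (symPhiMLAt 𝕜 ρ Z₀ Zb₀ c L μ y)))
  simp only [map_mul, map_invT, map_symPhiMLAt, snd_mapDual] at key
  exact key

/-- [folklore] **NATURALITY OF THE σ-JET** `symMσLAt` (common background). -/
theorem map_symMσLAt (ρ : Fin d → ℤ) (Z Zb' Z₀ Zb₀ b : Form1 d (Tau R)) (L : ℕ) (μ : Fin d) (y : Fin d → ℤ) :
    F (symMσLAt 𝕜 ρ Z Zb' Z₀ Zb₀ b L μ y)
      = symMσLAt 𝕜 ρ (fun κ x => F (Z κ x)) (fun κ x => F (Zb' κ x)) (fun κ x => F (Z₀ κ x)) (fun κ x => F (Zb₀ κ x))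
          (fun κ x => F (b κ x)) L μ y :=
  map_symMσGAt F ρ Z Zb' b Z₀ Zb₀ b L μ y

/-- [folklore] The mixed jet under a map of the letter algebra, read through `c11 ∘ F`. -/
theorem map_symMjetLAt_eq (ρ : Fin d → ℤ) (Z Zb' Z₀ Zb₀ b : Form1 d (Tau R)) (L : ℕ) (μ : Fin d) (y : Fin d → ℤ) :
    symMjetLAt 𝕜 ρ (fun κ x => F (Z κ x)) (fun κ x => F (Zb' κ x)) (fun κ x => F (Z₀ κ x)) (fun κ x => F (Zb₀ κ x))
        (fun κ x => F (b κ x)) L μ y = c11 (F (symMσLAt 𝕜 ρ Z Zb' Z₀ Zb₀ b L μ y)) := by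
  rw [symMjetLAt_eq_c11, map_symMσLAt]

end Naturality

/-! ## §2 The `τ₂`-flip and the oddness of the mixed jet in each fluctuation letter -/

section Flips

/-- [folklore] **THE MIXED JET IS ODD IN THE FIRST FLUCTUATION LETTER**: `M(−W, V; B) = −M(W, V; B)`. -/
theorem symMjetAt_neg_W (ρ : Fin d → ℤ) (W V B : Form1 d 𝔸) (L : ℕ) (μ : Fin d) (y : Fin d → ℤ) :
    symMjetAt 𝕜 ρ (-W) V B L μ y = -symMjetAt 𝕜 ρ W V B L μ y := by
  have h := map_symMjetLAt_eq (flip1 (𝕜 := 𝕜)) ρ (Zf 𝕜 W V) (Zb 𝕜 W V) (Zf 𝕜 0 0) (Zb 𝕜 0 0) (upF B) L μ y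
  simp only [flip1_Zf, flip1_Zb, neg_zero, upF_apply, flip1_ι, c11_flip1] at h
  rw [symMjetAt_eq_symMjetLAt, symMjetAt_eq_symMjetLAt, symMjetLAt_eq_c11 ρ (Zf 𝕜 W V) (Zb 𝕜 W V)]
  exact h

/-- [folklore] **THE MIXED JET IS ODD IN THE SECOND FLUCTUATION LETTER**: `M(W, −V; B) = −M(W, V; B)`. -/
theorem symMjetAt_neg_V (ρ : Fin d → ℤ) (W V B : Form1 d 𝔸) (L : ℕ) (μ : Fin d) (y : Fin d → ℤ) :
    symMjetAt 𝕜 ρ W (-V) B L μ y = -symMjetAt 𝕜 ρ W V B L μ y := by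
  have h := map_symMjetLAt_eq (flip2 𝕜) ρ (Zf 𝕜 W V) (Zb 𝕜 W V) (Zf 𝕜 0 0) (Zb 𝕜 0 0) (upF B) L μ y
  simp only [flip2_Zf, flip2_Zb, neg_zero, upF_apply, flip2_ι, c11_flip2] at h
  rw [symMjetAt_eq_symMjetLAt, symMjetAt_eq_symMjetLAt, symMjetLAt_eq_c11 ρ (Zf 𝕜 W V) (Zb 𝕜 W V)]
  exact h

end Flips

/-! ## §3 (the letter lemmas `R1g_single`∕`R1g_add`∕`R1g_neg`∕`R1g_sub`∕`R1g_R1g`∕`upF_single`∕`upF_R1g`: the comb module's, BY NAME) -/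

end Summit.QuantumFields.BalabanUV.Beta.SymRootedMixedJetSigns
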